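import Summits.BirchSwinnertonDyer.Rank1Residual.O5.CharTwistPrimeLevel
import HarnessLib

/-!
# O5/N10 (`p² ∣ N`, `p` odd): the twist by `(·/p)` is a Petersson ISOMETRY on `p`-depleted cusp forms

HONEST FRAMING (cell `b2b-bsdres`, run/shared/lean/b2b/bsd-rank1-residual/, verbatim in every
file): the goal of the cell is to DELETE the COMBINATION-SHAPED residual classes of the
Birch–Swinnerton-Dyer formula for ALL analytic-rank `≤ 1` elliptic curves over `ℚ` — assembled
STRICTLY from published theorems — so that the rank-`≤ 1` remainder becomes exactly the
CONSTRUCTION-SHAPED classes, which are TYPED, NOT attempted. This is not "finishing BSD". Lane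
CLASS-CLOSURE, team o5; o5-r2 GEN 7 (G7-2)/N2 'TWIN' and cc-typer-5's node `O5.CongruenceNumberTwin`
(ALL odd `p`); prover seat `b2b-bsdres-x11b3-p5` (gen. 7, cross-cell pool). THEOREMS ONLY; nothing
booked; no RESIDUAL-MAP mark / label / count moved. A TOOL file: nothing about any curve.

## What

For an odd prime `p` with `p² ∣ N`, `χ` the primitive quadratic character mod `p` and
`R f := charTwist N _ _ _ f` (`aₙ(R f) = χ(n) aₙ(f)`): **`⟨R f, R x⟩ = ⟨f, x⟩` for every `p`-DEPLETED
`f ∈ S_k(Γ₀(N))` (`aₙ(f) = 0` for `p ∣ n`) and every `x ∈ S_k(Γ₀(N))`**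
(`peterssonProduct_charTwist_charTwist`). Proof: pass to the finite-index level `Λ = Γ₀(N) ∩ Γ₁(p)`,
which the translations `T_u = [1, u/p; 0, 1]` normalise (`O5/CharTwistPrimeLevel.lean`); there
`R = g(χ)⁻¹ ∑_u χ(u) T_u`, `⟨T_u f, T_v x⟩_Λ = ⟨f, T_{v−u} x⟩_Λ` (Diamond–Shurman 5.5.2(a)), so
`∑_{u,v} χ(u)χ(v)⟨T_u f, T_v x⟩_Λ = ∑_w J(w)⟨f, T_w x⟩_Λ` with `J(w) = ∑_u χ(u)χ(u+w) = p·[w = 0] − 1`,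
i.e. `= p⟨f, x⟩_Λ − ⟨∑_w T_{−w} f, x⟩_Λ`, and `∑_w T_{−w} f = 0` for `p`-depleted `f` (`q`-expansion:
`∑_w e^{−2πinw/p} = p·[p ∣ n]`); times `|g(χ)|⁻² = 1/p`; finally `⟨·,·⟩_Λ = [Γ₀(N) : Λ]·⟨·,·⟩_{Γ₀(N)}`.
Consequences: orthogonality transport and `x − R(R x) ⊥ f` — the inputs of TWIN for all odd `p`
(`O5/CongruenceNumberTwistPrime.lean`). The case `p = 3` (where `Λ` can be replaced by `Γ₀(N)`) is
`O5/CharTwistThreeIsometry.lean`. No newform theory is used.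

References: [Shimura1971] Prop. 3.64; [DiamondShurman2005] Prop. 5.5.2(a), Exercise 5.4.4.
-/

noncomputable section

open scoped MatrixGroups ModularForm ComplexConjugate Real Pointwise

open Matrix.SpecialLinearGroup Matrix.GeneralLinearGroup UpperHalfPlane Complex ConjAct
  CongruenceSubgroup Literature.NumberTheory.EllipticCurves.ModularForms
  Literature.NumberTheory.Automorphic

namespace Summit.BirchSwinnertonDyer.Rank1Residual.O5.PrimeTwist

section Isometry

variable {N p : ℕ} [NeZero N] [hp : Fact p.Prime] {k : ℤ} (hpN : p ^ 2 ∣ N)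
  {χ : DirichletCharacter ℂ p} (hχ : χ.IsQuadratic)

omit [NeZero N] in
/-- Fourier coefficients of a finite sum of cusp forms on `Λ`. [folklore] -/
theorem cuspCoeff_sum_level {ι : Type*} (s : Finset ι) (F : ι → CuspForm (((Gamma0 N ⊓ Gamma1 p : Subgroup SL(2, ℤ)) : Subgroup (GL (Fin 2) ℝ))) k) (n : ℕ) :
    cuspCoeff (∑ i ∈ s, F i) n = ∑ i ∈ s, cuspCoeff (F i) n := by
  have hΓ := one_mem_strictPeriods_level (N := N) (p := p)
  induction s using Finset.cons_induction with
  | empty => simp [cuspCoeff_zero_form hΓ]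
  | cons a s ha ih => rw [Finset.sum_cons, Finset.sum_cons, cuspCoeff_add_form hΓ, ih]

omit [NeZero N] in
/-- Translates by congruent integers agree: `x ∣ [1, a/p; 0, 1] = x ∣ [1, b/p; 0, 1]` for
`a ≡ b (mod p)` and `x ∈ S_k(Γ₀(N))`. [folklore] -/
theorem translate_congr {x : CuspForm (Gamma0 N) k} {X : ℤ → CuspForm (((Gamma0 N ⊓ Gamma1 p : Subgroup SL(2, ℤ)) : Subgroup (GL (Fin 2) ℝ))) k}
    (hX : ∀ u : ℤ, (⇑(X u) : ℍ → ℂ) = (⇑x : ℍ → ℂ) ∣[k] glCast (translGL ((u : ℚ) / p) : GL (Fin 2) ℚ))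
    {a b : ℤ} (hab : (a : ZMod p) = (b : ZMod p)) : X a = X b := by
  obtain ⟨j, hj⟩ := (ZMod.intCast_eq_intCast_iff_dvd_sub b a p).mp hab.symm
  have hj' : (a : ℚ) = b + p * j := by
    have h : (a : ℤ) = b + p * j := by linear_combination hj
    exact_mod_cast h
  have hp0 : (p : ℚ) ≠ 0 := by exact_mod_cast hp.out.ne_zero
  apply DFunLike.ext'
  rw [hX, hX, show (a : ℚ) / p = (b : ℚ) / p + ((j : ℤ) : ℚ) by rw [hj']; field_simp]
  exact slash_translGL_add_intCast x _ j

omit [NeZero N] in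
/-- **`∑_{w mod p} T_{±w} f = 0` for a `p`-depleted `f`**: coefficientwise
`aₙ(f)·∑_w e^{±2πi n w/p} = aₙ(f)·p·[p ∣ n] = 0`. [folklore] -/
theorem sum_translates_eq_zero {f : CuspForm (Gamma0 N) k} (hf : ∀ n, p ∣ n → cuspCoeff f n = 0)
    {F : ℤ → CuspForm (((Gamma0 N ⊓ Gamma1 p : Subgroup SL(2, ℤ)) : Subgroup (GL (Fin 2) ℝ))) k}
    (hF : ∀ u : ℤ, (⇑(F u) : ℍ → ℂ) = (⇑f : ℍ → ℂ) ∣[k] glCast (translGL ((u : ℚ) / p) : GL (Fin 2) ℚ))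
    (ε : ℤ) (hε : ε = 1 ∨ ε = -1) : ∑ w : ZMod p, F (ε * (w.val : ℤ)) = 0 := by
  have hΓ := one_mem_strictPeriods_level (N := N) (p := p)
  refine eq_of_forall_cuspCoeff_eq hΓ fun n ↦ ?_
  rw [cuspCoeff_zero_form hΓ, cuspCoeff_sum_level]
  simp_rw [cuspCoeff_of_coe_eq_slash_translGL (hF _)]
  rw [← Finset.sum_mul]
  by_cases hn : p ∣ n
  · rw [hf n hn, mul_zero]
  · -- `∑_w e^{2πi ε n w/p} = 0` by orthogonality of additive characters
    have hb : ((ε * n : ℤ) : ZMod p) ≠ 0 := by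
      rw [ne_eq, ZMod.intCast_zmod_eq_zero_iff_dvd]
      rintro ⟨c, hc⟩
      apply hn
      have : (p : ℤ) ∣ n := by
        rcases hε with rfl | rfl
        · exact ⟨c, by linear_combination hc⟩
        · exact ⟨-c, by linear_combination -hc⟩
      exact_mod_cast this
    have hsum := AddChar.sum_mulShift ((ε * n : ℤ) : ZMod p) (ZMod.isPrimitive_stdAddChar p)
    rw [if_neg hb] at hsum
    have hterm : ∀ w : ZMod p, Complex.exp (2 * π * Complex.I * (((ε * (w.val : ℤ) : ℤ) : ℚ) / p : ℚ) * n) =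
        ZMod.stdAddChar (w * ((ε * n : ℤ) : ZMod p)) := by
      intro w
      rw [show w * ((ε * n : ℤ) : ZMod p) = ((ε * (w.val : ℤ) * n : ℤ) : ZMod p) by
        push_cast; rw [ZMod.natCast_zmod_val]; ring, ZMod.stdAddChar_coe]
      congr 1
      push_cast
      ring
    simp_rw [hterm]
    rw [hsum, Nat.cast_zero, zero_mul]

/-- **The twist, restricted to `Λ`, is `g(χ)⁻¹ ∑_u χ(u) T_u`**: if `⇑RΛ = ⇑(R y)` and
`⇑(Y u) = y ∣ T_{u/p}` on `Λ`, then `RΛ = g(χ⁻¹)⁻¹ • ∑_{u mod p} χ⁻¹(u) • Y(u)`. [cite: Shimura1971, Prop. 3.64] -/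
theorem eq_smul_sum_translates {y : CuspForm (Gamma0 N) k} {Y : ℤ → CuspForm (((Gamma0 N ⊓ Gamma1 p : Subgroup SL(2, ℤ)) : Subgroup (GL (Fin 2) ℝ))) k}
    (hY : ∀ u : ℤ, (⇑(Y u) : ℍ → ℂ) = (⇑y : ℍ → ℂ) ∣[k] glCast (translGL ((u : ℚ) / p) : GL (Fin 2) ℚ))
    {RL : CuspForm (((Gamma0 N ⊓ Gamma1 p : Subgroup SL(2, ℤ)) : Subgroup (GL (Fin 2) ℝ))) k} (hR : (⇑RL : ℍ → ℂ) = ⇑(charTwist N dvd_rfl hpN hχ y)) :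
    RL = (gaussSum χ⁻¹ (ZMod.stdAddChar (N := p)))⁻¹ • ∑ u : ZMod p, χ⁻¹ u • Y (u.val : ℤ) := by
  haveI : NeZero p := ⟨hp.out.ne_zero⟩
  apply DFunLike.ext'
  rw [hR, coe_charTwist, coe_twistRaw, CuspForm.IsGLPos.coe_smul]
  congr 1
  have h := map_sum (CuspForm.coeHom (Γ := (((Gamma0 N ⊓ Gamma1 p : Subgroup SL(2, ℤ)) : Subgroup (GL (Fin 2) ℝ)))) (k := k)) (fun u : ZMod p ↦ χ⁻¹ u • Y (u.val : ℤ))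
    Finset.univ
  refine (Finset.sum_congr rfl fun u _ ↦ ?_).trans h.symm
  change χ⁻¹ u • ((⇑y : ℍ → ℂ) ∣[k] twistT u) = ⇑(χ⁻¹ u • Y (u.val : ℤ))
  rw [CuspForm.IsGLPos.coe_smul, hY, ← glCast_translGL_eq_twistT u]

/-- **THE ISOMETRY ON `Λ`**: for `p`-depleted `f` and any `x` (both on `Γ₀(N)`, viewed on `Λ`),
`⟨R f, R x⟩_Λ = ⟨f, x⟩_Λ`. [cite: Shimura1971, Prop. 3.64] [cite: DiamondShurman2005, Prop. 5.5.2(a)] -/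
theorem peterssonProduct_charTwist_charTwist_level (hprim : χ.IsPrimitive)
    {f x : CuspForm (Gamma0 N) k} (hf : ∀ n, p ∣ n → cuspCoeff f n = 0)
    {fL xL RfL RxL : CuspForm (((Gamma0 N ⊓ Gamma1 p : Subgroup SL(2, ℤ)) : Subgroup (GL (Fin 2) ℝ))) k} (hfL : (⇑fL : ℍ → ℂ) = ⇑f) (hxL : (⇑xL : ℍ → ℂ) = ⇑x)
    (hRf : (⇑RfL : ℍ → ℂ) = ⇑(charTwist N dvd_rfl hpN hχ f))
    (hRx : (⇑RxL : ℍ → ℂ) = ⇑(charTwist N dvd_rfl hpN hχ x)) :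
    peterssonProduct (((Gamma0 N ⊓ Gamma1 p : Subgroup SL(2, ℤ)) : Subgroup (GL (Fin 2) ℝ))) k RfL RxL = peterssonProduct (((Gamma0 N ⊓ Gamma1 p : Subgroup SL(2, ℤ)) : Subgroup (GL (Fin 2) ℝ))) k fL xL := by
  haveI : NeZero p := ⟨hp.out.ne_zero⟩
  -- translates on `Λ`
  choose F hF' using fun u : ℤ ↦ exists_translate_level (k := k) hpN fL u
  choose X hX' using fun u : ℤ ↦ exists_translate_level (k := k) hpN xL u
  have hF : ∀ u : ℤ, (⇑(F u) : ℍ → ℂ) = (⇑f : ℍ → ℂ) ∣[k] glCast (translGL ((u : ℚ) / p) : GL (Fin 2) ℚ) :=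
    fun u ↦ by rw [hF', hfL]
  have hX : ∀ u : ℤ, (⇑(X u) : ℍ → ℂ) = (⇑x : ℍ → ℂ) ∣[k] glCast (translGL ((u : ℚ) / p) : GL (Fin 2) ℚ) :=
    fun u ↦ by rw [hX', hxL]
  have hX0 : X 0 = xL := by
    apply DFunLike.ext'
    rw [hX', Int.cast_zero, zero_div,
      show glCast (translGL 0 : GL (Fin 2) ℚ) = 1 from by
        refine Units.ext ?_; rw [coe_glCast_translGL, Rat.cast_zero]; ext i j
        fin_cases i <;> fin_cases j <;> simp,
      SlashAction.slash_one]
  -- `conj g⁻¹ · g⁻¹ = 1/p`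
  have hg2 : ‖gaussSum χ⁻¹ (ZMod.stdAddChar (N := p))‖ ^ 2 = (p : ℝ) := by
    exact_mod_cast Literature.NumberTheory.Sieve.LargeSieve.norm_gaussSum_sq (isPrimitive_inv hprim)
  have hcc : conj ((gaussSum χ⁻¹ (ZMod.stdAddChar (N := p)))⁻¹) *
      (gaussSum χ⁻¹ (ZMod.stdAddChar (N := p)))⁻¹ = ((p : ℂ))⁻¹ := by
    rw [← Complex.normSq_eq_conj_mul_self, map_inv₀, Complex.normSq_eq_norm_sq, hg2]
    push_cast
    rfl
  set g : ZMod p → ℂ := fun w ↦ peterssonProduct (((Gamma0 N ⊓ Gamma1 p : Subgroup SL(2, ℤ)) : Subgroup (GL (Fin 2) ℝ))) k fL (X (w.val : ℤ)) with hg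
  have hreal : ∀ u : ZMod p, conj (χ u) = χ u := fun u ↦ by
    rcases hχ u with h | h | h <;> simp [h]
  have hpair : ∀ u v : ZMod p, peterssonProduct (((Gamma0 N ⊓ Gamma1 p : Subgroup SL(2, ℤ)) : Subgroup (GL (Fin 2) ℝ))) k (F (u.val : ℤ)) (X (v.val : ℤ)) = g (v - u) := by
    intro u v
    show _ = peterssonProduct (((Gamma0 N ⊓ Gamma1 p : Subgroup SL(2, ℤ)) : Subgroup (GL (Fin 2) ℝ))) k fL (X ((v - u).val : ℤ))
    rw [peterssonProduct_translate_translate hpN (u := u.val) (v := v.val) (w := v.val - u.val)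
      (by ring) (hF' _) (hX' _) (hX' _)]
    congr 1
    exact translate_congr hX (by push_cast; simp only [ZMod.natCast_zmod_val])
  have hexpand : peterssonProduct (((Gamma0 N ⊓ Gamma1 p : Subgroup SL(2, ℤ)) : Subgroup (GL (Fin 2) ℝ))) k (∑ u : ZMod p, χ u • F (u.val : ℤ))
      (∑ v : ZMod p, χ v • X (v.val : ℤ)) = ∑ u : ZMod p, ∑ v : ZMod p, χ u * χ v * g (v - u) := by
    rw [peterssonProduct_sum_left]
    refine Finset.sum_congr rfl fun u _ ↦ ?_
    rw [peterssonProduct_smul_left, peterssonProduct_sum_right, Finset.mul_sum]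
    refine Finset.sum_congr rfl fun v _ ↦ ?_
    rw [peterssonProduct_smul_right, hreal, hpair]
    ring
  have hreindex : ∑ u : ZMod p, ∑ v : ZMod p, χ u * χ v * g (v - u) =
      ∑ w : ZMod p, (∑ u : ZMod p, χ u * χ (u + w)) * g w := by
    have h1 : ∀ u : ZMod p, ∑ v : ZMod p, χ u * χ v * g (v - u) =
        ∑ w : ZMod p, χ u * χ (u + w) * g w := fun u ↦
      Fintype.sum_equiv (Equiv.subRight u) _ _ fun v ↦ by
        simp only [Equiv.subRight_apply, add_sub_cancel]
    simp_rw [h1, Finset.sum_mul]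
    exact Finset.sum_comm
  have hJ : ∀ w : ZMod p, ∑ u : ZMod p, χ u * χ (u + w) = (if w = 0 then (p : ℂ) else 0) - 1 := by
    intro w
    split_ifs with hw
    · rw [hw]; simp_rw [add_zero]; rw [sum_chi_mul_chi hχ]
    · rw [sum_chi_mul_chi_add_of_ne_zero hχ hprim hw]; ring
  have hsumJ : ∑ w : ZMod p, (∑ u : ZMod p, χ u * χ (u + w)) * g w =
      p * g 0 - ∑ w : ZMod p, g w := by
    simp_rw [hJ, sub_mul, one_mul, ite_mul, zero_mul]
    rw [Finset.sum_sub_distrib, Finset.sum_ite_eq' Finset.univ (0 : ZMod p) (fun w ↦ (p : ℂ) * g w),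
      if_pos (Finset.mem_univ _)]
  -- `∑_w g w = ⟨∑_w F_{-w}, x⟩ = 0`
  have hgw : ∀ w : ZMod p, g w = peterssonProduct (((Gamma0 N ⊓ Gamma1 p : Subgroup SL(2, ℤ)) : Subgroup (GL (Fin 2) ℝ))) k (F (-(w.val : ℤ))) xL := by
    intro w
    show peterssonProduct (((Gamma0 N ⊓ Gamma1 p : Subgroup SL(2, ℤ)) : Subgroup (GL (Fin 2) ℝ))) k fL (X (w.val : ℤ)) = _
    rw [← hX0]
    exact (peterssonProduct_translate_translate hpN (u := -(w.val : ℤ)) (v := 0) (w := w.val)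
      (by ring) (hF' _) (hX' _) (hX' _)).symm
  have hsum0 : ∑ w : ZMod p, g w = 0 := by
    simp_rw [hgw]
    rw [← peterssonProduct_sum_left]
    have h0 := sum_translates_eq_zero (k := k) hf hF (-1) (Or.inr rfl)
    simp_rw [neg_one_mul] at h0
    rw [h0, peterssonProduct_zero_left]
  have hg0 : g 0 = peterssonProduct (((Gamma0 N ⊓ Gamma1 p : Subgroup SL(2, ℤ)) : Subgroup (GL (Fin 2) ℝ))) k fL xL := by
    show peterssonProduct (((Gamma0 N ⊓ Gamma1 p : Subgroup SL(2, ℤ)) : Subgroup (GL (Fin 2) ℝ))) k fL (X ((0 : ZMod p).val : ℤ)) = _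
    rw [ZMod.val_zero, Nat.cast_zero, hX0]
  have hp0 : (p : ℂ) ≠ 0 := by exact_mod_cast hp.out.ne_zero
  rw [eq_smul_sum_translates hpN hχ hF hRf, eq_smul_sum_translates hpN hχ hX hRx,
    peterssonProduct_smul_smul, hcc, hχ.inv, hexpand, hreindex, hsumJ, hsum0, hg0, sub_zero,
    ← mul_assoc, inv_mul_cancel₀ hp0, one_mul]

/-- **THE ISOMETRY: `⟨f ⊗ χ, x ⊗ χ⟩ = ⟨f, x⟩` on `S_k(Γ₀(N))` for every `p`-DEPLETED `f`
(`aₙ(f) = 0` for `p ∣ n`) and EVERY `x`** (`p` an odd prime — any prime — with `p² ∣ N`,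
`χ` the primitive quadratic character mod `p`): the level-`Λ` isometry divided by the index
`[Γ₀(N) : Λ]` (`peterssonProduct_of_le_eq_card_mul`). No newform theory is used.
[cite: Shimura1971, Prop. 3.64] [cite: DiamondShurman2005, Prop. 5.5.2(a) and Exercise 5.4.4] -/
theorem peterssonProduct_charTwist_charTwist (hprim : χ.IsPrimitive) {f : CuspForm (Gamma0 N) k}
    (hf : ∀ n, p ∣ n → cuspCoeff f n = 0) (x : CuspForm (Gamma0 N) k) :
    peterssonProduct (Gamma0 N) k (charTwist N dvd_rfl hpN hχ f) (charTwist N dvd_rfl hpN hχ x) =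
      peterssonProduct (Gamma0 N) k f x := by
  have hle := level_le (N := N) (p := p)
  have hSL : ((Gamma0 N : Subgroup SL(2, ℤ)) : Subgroup (GL (Fin 2) ℝ)) ≤ 𝒮ℒ :=
    Subgroup.map_le_range _ _
  obtain ⟨fL, hfL⟩ := exists_cuspForm_coe_eq_of_le hle f
  obtain ⟨xL, hxL⟩ := exists_cuspForm_coe_eq_of_le hle x
  obtain ⟨RfL, hRf⟩ := exists_cuspForm_coe_eq_of_le hle (charTwist N dvd_rfl hpN hχ f)
  obtain ⟨RxL, hRx⟩ := exists_cuspForm_coe_eq_of_le hle (charTwist N dvd_rfl hpN hχ x)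
  have h1 := peterssonProduct_of_le_eq_card_mul k hle hSL RfL RxL _ _ hRf hRx
  have h2 := peterssonProduct_of_le_eq_card_mul k hle hSL fL xL f x hfL hxL
  have hiso := peterssonProduct_charTwist_charTwist_level hpN hχ hprim hf hfL hxL hRf hRx
  rw [h1, h2] at hiso
  have hcard : (Nat.card (((Gamma0 N : Subgroup SL(2, ℤ)) : Subgroup (GL (Fin 2) ℝ)) ⧸
      ((((Gamma0 N ⊓ Gamma1 p : Subgroup SL(2, ℤ)) : Subgroup (GL (Fin 2) ℝ)))).subgroupOf ((Gamma0 N : Subgroup SL(2, ℤ)) : Subgroup (GL (Fin 2) ℝ))) : ℂ) ≠ 0 := by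
    have : Finite (((Gamma0 N : Subgroup SL(2, ℤ)) : Subgroup (GL (Fin 2) ℝ)) ⧸
        ((((Gamma0 N ⊓ Gamma1 p : Subgroup SL(2, ℤ)) : Subgroup (GL (Fin 2) ℝ)))).subgroupOf ((Gamma0 N : Subgroup SL(2, ℤ)) : Subgroup (GL (Fin 2) ℝ))) := by
      infer_instance
    exact_mod_cast Nat.card_pos.ne'
  exact mul_left_cancel₀ hcard hiso

/-- **Orthogonality transport**: `⟨f, x⟩ = 0 ⇒ ⟨f ⊗ χ, x ⊗ χ⟩ = 0` (`p`-depleted `f`).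
[cite: Shimura1971, Prop. 3.64] -/
theorem peterssonProduct_charTwist_charTwist_eq_zero (hprim : χ.IsPrimitive)
    {f : CuspForm (Gamma0 N) k} (hf : ∀ n, p ∣ n → cuspCoeff f n = 0) {x : CuspForm (Gamma0 N) k}
    (hx : peterssonProduct (Gamma0 N) k f x = 0) :
    peterssonProduct (Gamma0 N) k (charTwist N dvd_rfl hpN hχ f) (charTwist N dvd_rfl hpN hχ x) = 0 := by
  rw [peterssonProduct_charTwist_charTwist hpN hχ hprim hf, hx]

/-- **`x − (x ⊗ χ) ⊗ χ ⊥ f`** for `p`-depleted `f` and every `x`: `⟨f, RRx⟩ = ⟨RRf, RRx⟩ = ⟨Rf, Rx⟩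
= ⟨f, x⟩` (isometry twice, `RRf = f`). [cite: Shimura1971, Prop. 3.64] -/
theorem peterssonProduct_sub_charTwist_charTwist_eq_zero (hprim : χ.IsPrimitive)
    {f : CuspForm (Gamma0 N) k} (hf : ∀ n, p ∣ n → cuspCoeff f n = 0) (x : CuspForm (Gamma0 N) k) :
    peterssonProduct (Gamma0 N) k f
      (x - charTwist N dvd_rfl hpN hχ (charTwist N dvd_rfl hpN hχ x)) = 0 := by
  have h2 := peterssonProduct_charTwist_charTwist hpN hχ hprim
    (f := charTwist N dvd_rfl hpN hχ f) (fun n hn ↦ cuspCoeff_charTwist_eq_zero_of_dvd hpN hχ hprim f hn)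
    (charTwist N dvd_rfl hpN hχ x)
  rw [charTwist_charTwist hpN hχ hprim hf, peterssonProduct_charTwist_charTwist hpN hχ hprim hf] at h2
  rw [sub_eq_add_neg, peterssonProduct_add_right, ← neg_one_smul ℂ (charTwist N dvd_rfl hpN hχ _),
    peterssonProduct_smul_right, h2, neg_one_mul, add_neg_cancel]

end Isometry

end Summit.BirchSwinnertonDyer.Rank1Residual.O5.PrimeTwist
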